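import Summits.Ventures.PercRepro.S4MidKeyBaseEight

/-!
# PercRepro — THE MIDDLE KEY AT LEVEL `9`: THE BASE (p1, gen 46; an S4 feeder — p9 owns SUBCLAIM-S4; no window claim here)

The level-`9` ingredients of the middle key (see S4MidKeyBase / S4MidKeyBaseEight for levels `7` / `8`): `topCount_le_sum_uSets_nine`
(`#U(p, 9) ≤ Σ_{9 ≤ k ≤ 319} #uSets k`: a `U`-set's complement is a rank-`9` set of `9 … 319` points on the `e`-free core, `f(9) = 319`)
and the numerals `phiK_<word>_nine` (`Φ(p, 9)` for `p = 11 … 40`, from `phiK_eq_two_pow_sub`). Coloops are not excluded. Axioms: standard.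
-/

open scoped Matroid

namespace PercRepro

namespace S4Mid

open Set Finset S2LP S3Mid

variable {α : Type} {M : Matroid α} [M.Finite]

/-- **`#U(p, 9) ≤ Σ_{9 ≤ k ≤ 319} #uSets k`**: the complement of a `U`-set is a rank-`9` set, of `9 … 319` points when every
rank-`9` set has `≤ 319` points. -/
theorem topCount_le_sum_uSets_nine (p : ℕ) (h319 : ∀ X ⊆ M.E, M.eRk X ≤ ((9 : ℕ) : ℕ∞) → X.ncard ≤ 319)
    (hn319 : 319 ≤ M.E.ncard) :
    Matroid.topCount M p 9 ≤ ∑ i ∈ Finset.range 311, (uSets M p 9 (9 + i)).ncard := by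
  rw [topCount_eq_sum_uSets, ← S3LP.sum_Icc_eq_sum_range (fun k => (uSets M p 9 k).ncard) 9 319]
  refine le_of_eq (Finset.sum_subset ?_ ?_).symm
  · intro k hk
    simp only [Finset.mem_Icc] at hk
    simp only [Finset.mem_range]
    omega
  · intro k _ hk
    simp only [Finset.mem_Icc, not_and_or, not_le] at hk
    have h1 := ncard_uSets_le_rkSets (M := M) p 9 k
    rcases hk with hk | hk
    · rw [S3LP.z_lt k 9 hk] at h1; omega
    · rw [rkSets_eq_empty_of_flat h319 le_rfl hk, Set.ncard_empty] at h1; omega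

/-- `Φ(11, 9) = 11 / 10`. -/
theorem phiK_eleven_nine : phiK 11 9 = 11 / 10 := by
  rw [HypKey.phiK_eq_two_pow_sub 11 9 (by norm_num), Nat.choose_symm_add]
  simp only [Finset.sum_range_succ, Finset.sum_range_zero]
  norm_num [Nat.choose_eq_descFactorial_div_factorial, Nat.descFactorial_succ, Nat.descFactorial_zero, Nat.factorial]

/-- `Φ(12, 9) = 12 / 5`. -/
theorem phiK_twelve_nine : phiK 12 9 = 12 / 5 := by
  rw [HypKey.phiK_eq_two_pow_sub 12 9 (by norm_num), Nat.choose_symm_add]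
  simp only [Finset.sum_range_succ, Finset.sum_range_zero]
  norm_num [Nat.choose_eq_descFactorial_div_factorial, Nat.descFactorial_succ, Nat.descFactorial_zero, Nat.factorial]

/-- `Φ(13, 9) = 221 / 55`. -/
theorem phiK_thirteen_nine : phiK 13 9 = 221 / 55 := by
  rw [HypKey.phiK_eq_two_pow_sub 13 9 (by norm_num), Nat.choose_symm_add]
  simp only [Finset.sum_range_succ, Finset.sum_range_zero]
  norm_num [Nat.choose_eq_descFactorial_div_factorial, Nat.descFactorial_succ, Nat.descFactorial_zero, Nat.factorial]

/-- `Φ(14, 9) = 336 / 55`. -/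
theorem phiK_fourteen_nine : phiK 14 9 = 336 / 55 := by
  rw [HypKey.phiK_eq_two_pow_sub 14 9 (by norm_num), Nat.choose_symm_add]
  simp only [Finset.sum_range_succ, Finset.sum_range_zero]
  norm_num [Nat.choose_eq_descFactorial_div_factorial, Nat.descFactorial_succ, Nat.descFactorial_zero, Nat.factorial]

/-- `Φ(15, 9) = 391 / 44`. -/
theorem phiK_fifteen_nine : phiK 15 9 = 391 / 44 := by
  rw [HypKey.phiK_eq_two_pow_sub 15 9 (by norm_num), Nat.choose_symm_add]
  simp only [Finset.sum_range_succ, Finset.sum_range_zero]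
  norm_num [Nat.choose_eq_descFactorial_div_factorial, Nat.descFactorial_succ, Nat.descFactorial_zero, Nat.factorial]

/-- `Φ(16, 9) = 696 / 55`. -/
theorem phiK_sixteen_nine : phiK 16 9 = 696 / 55 := by
  rw [HypKey.phiK_eq_two_pow_sub 16 9 (by norm_num), Nat.choose_symm_add]
  simp only [Finset.sum_range_succ, Finset.sum_range_zero]
  norm_num [Nat.choose_eq_descFactorial_div_factorial, Nat.descFactorial_succ, Nat.descFactorial_zero, Nat.factorial]

/-- `Φ(17, 9) = 12767 / 715`. -/
theorem phiK_seventeen_nine : phiK 17 9 = 12767 / 715 := by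
  rw [HypKey.phiK_eq_two_pow_sub 17 9 (by norm_num), Nat.choose_symm_add]
  simp only [Finset.sum_range_succ, Finset.sum_range_zero]
  norm_num [Nat.choose_eq_descFactorial_div_factorial, Nat.descFactorial_succ, Nat.descFactorial_zero, Nat.factorial]

/-- `Φ(18, 9) = 17976 / 715`. -/
theorem phiK_eighteen_nine : phiK 18 9 = 17976 / 715 := by
  rw [HypKey.phiK_eq_two_pow_sub 18 9 (by norm_num), Nat.choose_symm_add]
  simp only [Finset.sum_range_succ, Finset.sum_range_zero]
  norm_num [Nat.choose_eq_descFactorial_div_factorial, Nat.descFactorial_succ, Nat.descFactorial_zero, Nat.factorial]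

/-- `Φ(19, 9) = 355129 / 10010`. -/
theorem phiK_nineteen_nine : phiK 19 9 = 355129 / 10010 := by
  rw [HypKey.phiK_eq_two_pow_sub 19 9 (by norm_num), Nat.choose_symm_add]
  simp only [Finset.sum_range_succ, Finset.sum_range_zero]
  norm_num [Nat.choose_eq_descFactorial_div_factorial, Nat.descFactorial_succ, Nat.descFactorial_zero, Nat.factorial]

/-- `Φ(20, 9) = 50364 / 1001`. -/
theorem phiK_twenty_nine : phiK 20 9 = 50364 / 1001 := by
  rw [HypKey.phiK_eq_two_pow_sub 20 9 (by norm_num), Nat.choose_symm_add]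
  simp only [Finset.sum_range_succ, Finset.sum_range_zero]
  norm_num [Nat.choose_eq_descFactorial_div_factorial, Nat.descFactorial_succ, Nat.descFactorial_zero, Nat.factorial]

/-- `Φ(21, 9) = 10273 / 143`. -/
theorem phiK_twentyone_nine : phiK 21 9 = 10273 / 143 := by
  rw [HypKey.phiK_eq_two_pow_sub 21 9 (by norm_num), Nat.choose_symm_add]
  simp only [Finset.sum_range_succ, Finset.sum_range_zero]
  norm_num [Nat.choose_eq_descFactorial_div_factorial, Nat.descFactorial_succ, Nat.descFactorial_zero, Nat.factorial]

/-- `Φ(22, 9) = 1344 / 13`. -/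
theorem phiK_twentytwo_nine : phiK 22 9 = 1344 / 13 := by
  rw [HypKey.phiK_eq_two_pow_sub 22 9 (by norm_num), Nat.choose_symm_add]
  simp only [Finset.sum_range_succ, Finset.sum_range_zero]
  norm_num [Nat.choose_eq_descFactorial_div_factorial, Nat.descFactorial_succ, Nat.descFactorial_zero, Nat.factorial]

/-- `Φ(23, 9) = 31211 / 208`. -/
theorem phiK_twentythree_nine : phiK 23 9 = 31211 / 208 := by
  rw [HypKey.phiK_eq_two_pow_sub 23 9 (by norm_num), Nat.choose_symm_add]
  simp only [Finset.sum_range_succ, Finset.sum_range_zero]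
  norm_num [Nat.choose_eq_descFactorial_div_factorial, Nat.descFactorial_succ, Nat.descFactorial_zero, Nat.factorial]

/-- `Φ(24, 9) = 31419 / 143`. -/
theorem phiK_twentyfour_nine : phiK 24 9 = 31419 / 143 := by
  rw [HypKey.phiK_eq_two_pow_sub 24 9 (by norm_num), Nat.choose_symm_add]
  simp only [Finset.sum_range_succ, Finset.sum_range_zero]
  norm_num [Nat.choose_eq_descFactorial_div_factorial, Nat.descFactorial_succ, Nat.descFactorial_zero, Nat.factorial]

/-- `Φ(25, 9) = 789050 / 2431`. -/
theorem phiK_twentyfive_nine : phiK 25 9 = 789050 / 2431 := by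
  rw [HypKey.phiK_eq_two_pow_sub 25 9 (by norm_num), Nat.choose_symm_add]
  simp only [Finset.sum_range_succ, Finset.sum_range_zero]
  norm_num [Nat.choose_eq_descFactorial_div_factorial, Nat.descFactorial_succ, Nat.descFactorial_zero, Nat.factorial]

/-- `Φ(26, 9) = 3165924 / 6545`. -/
theorem phiK_twentysix_nine : phiK 26 9 = 3165924 / 6545 := by
  rw [HypKey.phiK_eq_two_pow_sub 26 9 (by norm_num), Nat.choose_symm_add]
  simp only [Finset.sum_range_succ, Finset.sum_range_zero]
  norm_num [Nat.choose_eq_descFactorial_div_factorial, Nat.descFactorial_succ, Nat.descFactorial_zero, Nat.factorial]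

/-- `Φ(27, 9) = 9517407 / 13090`. -/
theorem phiK_twentyseven_nine : phiK 27 9 = 9517407 / 13090 := by
  rw [HypKey.phiK_eq_two_pow_sub 27 9 (by norm_num), Nat.choose_symm_add]
  simp only [Finset.sum_range_succ, Finset.sum_range_zero]
  norm_num [Nat.choose_eq_descFactorial_div_factorial, Nat.descFactorial_succ, Nat.descFactorial_zero, Nat.factorial]

/-- `Φ(28, 9) = 1030324 / 935`. -/
theorem phiK_twentyeight_nine : phiK 28 9 = 1030324 / 935 := by
  rw [HypKey.phiK_eq_two_pow_sub 28 9 (by norm_num), Nat.choose_symm_add]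
  simp only [Finset.sum_range_succ, Finset.sum_range_zero]
  norm_num [Nat.choose_eq_descFactorial_div_factorial, Nat.descFactorial_succ, Nat.descFactorial_zero, Nat.factorial]

/-- `Φ(29, 9) = 29906511 / 17765`. -/
theorem phiK_twentynine_nine : phiK 29 9 = 29906511 / 17765 := by
  rw [HypKey.phiK_eq_two_pow_sub 29 9 (by norm_num), Nat.choose_symm_add]
  simp only [Finset.sum_range_succ, Finset.sum_range_zero]
  norm_num [Nat.choose_eq_descFactorial_div_factorial, Nat.descFactorial_succ, Nat.descFactorial_zero, Nat.factorial]

/-- `Φ(30, 9) = 119697104 / 46189`. -/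
theorem phiK_thirty_nine : phiK 30 9 = 119697104 / 46189 := by
  rw [HypKey.phiK_eq_two_pow_sub 30 9 (by norm_num), Nat.choose_symm_add]
  simp only [Finset.sum_range_succ, Finset.sum_range_zero]
  norm_num [Nat.choose_eq_descFactorial_div_factorial, Nat.descFactorial_succ, Nat.descFactorial_zero, Nat.factorial]

/-- `Φ(31, 9) = 3712042083 / 923780`. -/
theorem phiK_thirtyone_nine : phiK 31 9 = 3712042083 / 923780 := by
  rw [HypKey.phiK_eq_two_pow_sub 31 9 (by norm_num), Nat.choose_symm_add]
  simp only [Finset.sum_range_succ, Finset.sum_range_zero]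
  norm_num [Nat.choose_eq_descFactorial_div_factorial, Nat.descFactorial_succ, Nat.descFactorial_zero, Nat.factorial]

/-- `Φ(32, 9) = 1448962288 / 230945`. -/
theorem phiK_thirtytwo_nine : phiK 32 9 = 1448962288 / 230945 := by
  rw [HypKey.phiK_eq_two_pow_sub 32 9 (by norm_num), Nat.choose_symm_add]
  simp only [Finset.sum_range_succ, Finset.sum_range_zero]
  norm_num [Nat.choose_eq_descFactorial_div_factorial, Nat.descFactorial_succ, Nat.descFactorial_zero, Nat.factorial]

/-- `Φ(33, 9) = 1449193233 / 146965`. -/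
theorem phiK_thirtythree_nine : phiK 33 9 = 1449193233 / 146965 := by
  rw [HypKey.phiK_eq_two_pow_sub 33 9 (by norm_num), Nat.choose_symm_add]
  simp only [Finset.sum_range_succ, Finset.sum_range_zero]
  norm_num [Nat.choose_eq_descFactorial_div_factorial, Nat.descFactorial_succ, Nat.descFactorial_zero, Nat.factorial]

/-- `Φ(34, 9) = 134822344 / 8645`. -/
theorem phiK_thirtyfour_nine : phiK 34 9 = 134822344 / 8645 := by
  rw [HypKey.phiK_eq_two_pow_sub 34 9 (by norm_num), Nat.choose_symm_add]
  simp only [Finset.sum_range_succ, Finset.sum_range_zero]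
  norm_num [Nat.choose_eq_descFactorial_div_factorial, Nat.descFactorial_succ, Nat.descFactorial_zero, Nat.factorial]

/-- `Φ(35, 9) = 134830989 / 5434`. -/
theorem phiK_thirtyfive_nine : phiK 35 9 = 134830989 / 5434 := by
  rw [HypKey.phiK_eq_two_pow_sub 35 9 (by norm_num), Nat.choose_symm_add]
  simp only [Finset.sum_range_succ, Finset.sum_range_zero]
  norm_num [Nat.choose_eq_descFactorial_div_factorial, Nat.descFactorial_succ, Nat.descFactorial_zero, Nat.factorial]

/-- `Φ(36, 9) = 539345692 / 13585`. -/
theorem phiK_thirtysix_nine : phiK 36 9 = 539345692 / 13585 := by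
  rw [HypKey.phiK_eq_two_pow_sub 36 9 (by norm_num), Nat.choose_symm_add]
  simp only [Finset.sum_range_succ, Finset.sum_range_zero]
  norm_num [Nat.choose_eq_descFactorial_div_factorial, Nat.descFactorial_succ, Nat.descFactorial_zero, Nat.factorial]

/-- `Φ(37, 9) = 19956293249 / 312455`. -/
theorem phiK_thirtyseven_nine : phiK 37 9 = 19956293249 / 312455 := by
  rw [HypKey.phiK_eq_two_pow_sub 37 9 (by norm_num), Nat.choose_symm_add]
  simp only [Finset.sum_range_succ, Finset.sum_range_zero]
  norm_num [Nat.choose_eq_descFactorial_div_factorial, Nat.descFactorial_succ, Nat.descFactorial_zero, Nat.factorial]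

/-- `Φ(38, 9) = 1698434528 / 16445`. -/
theorem phiK_thirtyeight_nine : phiK 38 9 = 1698434528 / 16445 := by
  rw [HypKey.phiK_eq_two_pow_sub 38 9 (by norm_num), Nat.choose_symm_add]
  simp only [Finset.sum_range_succ, Finset.sum_range_zero]
  norm_num [Nat.choose_eq_descFactorial_div_factorial, Nat.descFactorial_succ, Nat.descFactorial_zero, Nat.factorial]

/-- `Φ(39, 9) = 1698450973 / 10120`. -/
theorem phiK_thirtynine_nine : phiK 39 9 = 1698450973 / 10120 := by
  rw [HypKey.phiK_eq_two_pow_sub 39 9 (by norm_num), Nat.choose_symm_add]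
  simp only [Finset.sum_range_succ, Finset.sum_range_zero]
  norm_num [Nat.choose_eq_descFactorial_div_factorial, Nat.descFactorial_succ, Nat.descFactorial_zero, Nat.factorial]

/-- `Φ(40, 9) = 485274598 / 1771`. -/
theorem phiK_forty_nine : phiK 40 9 = 485274598 / 1771 := by
  rw [HypKey.phiK_eq_two_pow_sub 40 9 (by norm_num), Nat.choose_symm_add]
  simp only [Finset.sum_range_succ, Finset.sum_range_zero]
  norm_num [Nat.choose_eq_descFactorial_div_factorial, Nat.descFactorial_succ, Nat.descFactorial_zero, Nat.factorial]

end S4Mid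

end PercRepro
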